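import Mathlib

/-!
# Defect transport in a contraction metric (solo-blind kernel #179)

Paper `steady-zeroth-law.md` §24.105 / PLAN §105 (E1-lite).  A floating-point trajectory `W̃` of the deleted chain
`W' = D(t) W + F` is certified through its defect `δ = W̃' - D W̃ - F`: the error `e = W - W̃` solves `e' = D e - δ`, and if
the metric (here: the norm of a real inner-product space, LEMMA C's `Y(t)` frozen on the sub-interval) gives the one-sided
estimate `⟪e, D e⟫ ≤ -q ‖e‖²`, then `⟪e, e'⟫ ≤ -q ‖e‖² + ‖e‖ ‖δ‖` and the error obeys the Duhamel bound below — for ANY sign of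
`q`, with no dependence on `‖D‖` (the chain is stiff).  Kernel #178 chains these one-interval bounds across grid points.

* `metricTransport_core` — `⟪e t, e' t⟫ ≤ ‖e t‖ δ t` on `[a, b]` ⇒ `‖e b‖ ≤ ‖e a‖ + ∫_a^b δ`;
* `metricTransport` — `⟪e t, e' t⟫ ≤ -q ‖e t‖² + ‖e t‖ δ t` on `[a, b]` ⇒
  `‖e b‖ ≤ e^{-q (b - a)} ‖e a‖ + ∫_a^b e^{-q (b - t)} δ t`.
-/

namespace Summit.AnomalousDissipation.AnomalousDissipation.Theorems

open Real Set MeasureTheory intervalIntegral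
open scoped InnerProductSpace

variable {E : Type*} [NormedAddCommGroup E] [InnerProductSpace ℝ E]

/-- Square-root Grönwall: a curve with `⟪e, e'⟫ ≤ ‖e‖ δ` (`δ ≥ 0` continuous) grows at most like `∫ δ`. -/
theorem metricTransport_core {e e' : ℝ → E} {δ : ℝ → ℝ} {a b : ℝ} (hab : a ≤ b)
    (he : ∀ t, HasDerivAt e (e' t) t) (hδ : Continuous δ) (hδ0 : ∀ t, 0 ≤ δ t)
    (hineq : ∀ t ∈ Icc a b, ⟪e t, e' t⟫_ℝ ≤ ‖e t‖ * δ t) :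
    ‖e b‖ ≤ ‖e a‖ + ∫ t in a..b, δ t := by
  refine le_of_forall_pos_le_add fun ε hε => ?_
  -- regularised norm `z t = √(⟪e t, e t⟫ + ε²)`
  set z : ℝ → ℝ := fun t => Real.sqrt (⟪e t, e t⟫_ℝ + ε ^ 2) with hz
  have hpos : ∀ t, 0 < ⟪e t, e t⟫_ℝ + ε ^ 2 := fun t => by
    have := real_inner_self_nonneg (x := e t); positivity
  have hzpos : ∀ t, 0 < z t := fun t => Real.sqrt_pos.2 (hpos t)
  have hnorm_le_z : ∀ t, ‖e t‖ ≤ z t := fun t => by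
    rw [hz]; dsimp only
    calc ‖e t‖ = Real.sqrt (‖e t‖ ^ 2) := (Real.sqrt_sq (norm_nonneg _)).symm
      _ ≤ Real.sqrt (⟪e t, e t⟫_ℝ + ε ^ 2) :=
          Real.sqrt_le_sqrt (by rw [real_inner_self_eq_norm_sq]; nlinarith [sq_nonneg ε])
  -- derivative of z
  have hzd : ∀ t, HasDerivAt z ((⟪e t, e' t⟫_ℝ + ⟪e' t, e t⟫_ℝ) / (2 * Real.sqrt (⟪e t, e t⟫_ℝ + ε ^ 2))) t := by
    intro t
    have h1 : HasDerivAt (fun s => ⟪e s, e s⟫_ℝ + ε ^ 2) (⟪e t, e' t⟫_ℝ + ⟪e' t, e t⟫_ℝ) t :=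
      ((he t).inner ℝ (he t)).add_const (ε ^ 2)
    exact h1.sqrt (hpos t).ne'
  have hzd_le : ∀ t ∈ Icc a b, (⟪e t, e' t⟫_ℝ + ⟪e' t, e t⟫_ℝ) / (2 * Real.sqrt (⟪e t, e t⟫_ℝ + ε ^ 2)) ≤ δ t := by
    intro t ht
    have h2 : ⟪e' t, e t⟫_ℝ = ⟪e t, e' t⟫_ℝ := real_inner_comm _ _
    rw [h2, div_le_iff₀ (mul_pos two_pos (Real.sqrt_pos.2 (hpos t)))]
    have h3 := hineq t ht
    have h4 : ‖e t‖ ≤ Real.sqrt (⟪e t, e t⟫_ℝ + ε ^ 2) := hnorm_le_z t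
    have h5 := hδ0 t
    nlinarith [mul_le_mul_of_nonneg_right h4 h5]
  -- G t = z t - ∫_a^t δ is antitone on [a, b]
  set G : ℝ → ℝ := fun t => z t - ∫ s in a..t, δ s with hG
  have hGd : ∀ t, HasDerivAt G ((⟪e t, e' t⟫_ℝ + ⟪e' t, e t⟫_ℝ) / (2 * Real.sqrt (⟪e t, e t⟫_ℝ + ε ^ 2)) - δ t) t :=
    fun t => (hzd t).sub (hδ.integral_hasStrictDerivAt a t).hasDerivAt
  have hanti : AntitoneOn G (Icc a b) := by
    refine antitoneOn_of_deriv_nonpos (convex_Icc a b) ?_ ?_ ?_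
    · exact fun t _ => (hGd t).continuousAt.continuousWithinAt
    · exact fun t _ => (hGd t).differentiableAt.differentiableWithinAt
    · intro t ht
      rw [interior_Icc] at ht
      rw [(hGd t).deriv]
      have := hzd_le t ⟨ht.1.le, ht.2.le⟩
      linarith
  have hGab : G b ≤ G a := hanti (left_mem_Icc.2 hab) (right_mem_Icc.2 hab) hab
  have hGa : G a = z a := by simp [hG]
  have hza : z a ≤ ‖e a‖ + ε := by
    rw [hz]; dsimp only
    calc Real.sqrt (⟪e a, e a⟫_ℝ + ε ^ 2) ≤ Real.sqrt ((‖e a‖ + ε) ^ 2) :=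
          Real.sqrt_le_sqrt (by rw [real_inner_self_eq_norm_sq]; nlinarith [norm_nonneg (e a), hε.le])
      _ = ‖e a‖ + ε := Real.sqrt_sq (by positivity)
  have hzb : ‖e b‖ ≤ z b := hnorm_le_z b
  have hGb : G b = z b - ∫ s in a..b, δ s := rfl
  linarith

/-- **Defect transport in a contraction metric.**  If `⟪e t, e' t⟫ ≤ -q ‖e t‖² + ‖e t‖ δ t` on `[a, b]`
(`δ ≥ 0` continuous, any real `q`), then `‖e b‖ ≤ e^{-q (b-a)} ‖e a‖ + ∫_a^b e^{-q (b-t)} δ t dt`. -/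
theorem metricTransport {e e' : ℝ → E} {δ : ℝ → ℝ} {q a b : ℝ} (hab : a ≤ b)
    (he : ∀ t, HasDerivAt e (e' t) t) (hδ : Continuous δ) (hδ0 : ∀ t, 0 ≤ δ t)
    (hineq : ∀ t ∈ Icc a b, ⟪e t, e' t⟫_ℝ ≤ -q * ‖e t‖ ^ 2 + ‖e t‖ * δ t) :
    ‖e b‖ ≤ Real.exp (-q * (b - a)) * ‖e a‖ + ∫ t in a..b, Real.exp (-q * (b - t)) * δ t := by
  -- twisted curve φ t = e^{q t} • e t
  set φ : ℝ → E := fun t => Real.exp (q * t) • e t with hφ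
  set φ' : ℝ → E := fun t => Real.exp (q * t) • e' t + (Real.exp (q * t) * q) • e t with hφ'
  have hexp : ∀ t, HasDerivAt (fun s => Real.exp (q * s)) (Real.exp (q * t) * q) t := fun t => by
    have := ((hasDerivAt_id t).const_mul q).exp
    simpa using this
  have hφd : ∀ t, HasDerivAt φ (φ' t) t := fun t => (hexp t).smul (he t)
  have hnφ : ∀ t, ‖φ t‖ = Real.exp (q * t) * ‖e t‖ := fun t => by
    rw [hφ]; dsimp only; rw [norm_smul, Real.norm_eq_abs, abs_of_pos (Real.exp_pos _)]
  have hineqφ : ∀ t ∈ Icc a b, ⟪φ t, φ' t⟫_ℝ ≤ ‖φ t‖ * (Real.exp (q * t) * δ t) := by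
    intro t ht
    have h := hineq t ht
    have hE : 0 < Real.exp (q * t) := Real.exp_pos _
    rw [hnφ t]
    rw [hφ, hφ']; dsimp only
    rw [inner_add_right, real_inner_smul_left, real_inner_smul_right, real_inner_smul_left, real_inner_smul_right,
      real_inner_self_eq_norm_sq]
    have : Real.exp (q * t) * (Real.exp (q * t) * ⟪e t, e' t⟫_ℝ) + Real.exp (q * t) * (Real.exp (q * t) * q * ‖e t‖ ^ 2)
        = Real.exp (q * t) * Real.exp (q * t) * (⟪e t, e' t⟫_ℝ + q * ‖e t‖ ^ 2) := by ring
    rw [this]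
    have h2 : ⟪e t, e' t⟫_ℝ + q * ‖e t‖ ^ 2 ≤ ‖e t‖ * δ t := by linarith
    calc Real.exp (q * t) * Real.exp (q * t) * (⟪e t, e' t⟫_ℝ + q * ‖e t‖ ^ 2)
        ≤ Real.exp (q * t) * Real.exp (q * t) * (‖e t‖ * δ t) := by gcongr
      _ = Real.exp (q * t) * ‖e t‖ * (Real.exp (q * t) * δ t) := by ring
  have hcore := metricTransport_core hab hφd (by fun_prop) (fun t => by have := hδ0 t; positivity) hineqφ
  -- unfold the twist
  rw [hnφ b, hnφ a] at hcore
  have hEb : 0 < Real.exp (q * b) := Real.exp_pos _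
  have key : ‖e b‖ ≤ Real.exp (-(q * b)) * (Real.exp (q * a) * ‖e a‖ + ∫ t in a..b, Real.exp (q * t) * δ t) := by
    rw [Real.exp_neg, ← div_eq_inv_mul, le_div_iff₀ hEb]
    linarith
  refine key.trans (le_of_eq ?_)
  rw [mul_add, ← mul_assoc, ← Real.exp_add, ← intervalIntegral.integral_const_mul]
  congr 1
  · congr 1; ring_nf
  · refine intervalIntegral.integral_congr fun t _ => ?_
    show Real.exp (-(q * b)) * (Real.exp (q * t) * δ t) = Real.exp (-q * (b - t)) * δ t
    rw [← mul_assoc, ← Real.exp_add]; congr 1; ring_nf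

end Summit.AnomalousDissipation.AnomalousDissipation.Theorems
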